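import Literature.Geometry.Lorentzian.KerrConvergence
import Literature.Geometry.Lorentzian.FinalState
import Literature.Geometry.Lorentzian.LeafAdaptedModelChartsMinkowski
import HarnessLib

/-!
# The hypothesis structure `FinalStateDecomposition` is inhabited (Minkowski space), and exactly
# where it is trivially empty (carrier census libB-FinalStateConjecture-07)

`FinalStateDecomposition 𝓢 𝒟 k` (`KerrConvergence.lean`) is the *hypothesis structure* of the
`N`-black-hole final state of the region `𝒟 ⊆ 𝓢.carrier` in `Cᵏ`: `N` late-time charts on boosted
Kerr exteriors, one flat (radiation-zone) chart, near-zone and radiation-zone `Cᵏ` convergence,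
separation of the holes and one covering clause. Some 100 route items of the summit
`FinalStateConjecture` quantify over it (`∃ (O : Set 𝒟.carrier) (d : FinalStateDecomposition
𝒟.toSpacetime O 2), …` in the statement; `∀ d : FinalStateDecomposition …` in the cruxes). Being a
hypothesis structure it is **not** inhabited at all parameters — it is a genuinely conditional
carrier — and this file records the two halves of that statement, everything proved:

* **Inhabited (explicit, standard witness).** Minkowski space, as the vacuum Cauchy development
  `Minkowski.vacuumCauchyDevelopment` of the trivial data `(ℝ³, δ, 0)`
  (`MinkowskiCauchyDevelopment.lean`; `vacuumCauchyDevelopment.toSpacetime = Minkowski.spacetime`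
  by `rfl`), carries for every `k`, every `τ₀` and every region `O ⊇ {x⁰ > τ₀}` the **trivial
  final state decomposition** `Minkowski.finalStateDecomposition`: no black hole (`N = 0`), flat
  chart the identity `Subtype.val : E4 ⊇ ⊤ → E4` after `τ₀`, whose `Cᵏ` deviation from `η`
  vanishes identically (`Minkowski.deviationCk_vacuumCauchyDevelopment_subtypeVal`) and whose
  covering clause holds because a point not later than `τ₀` lies in the causal past of the point
  `(τ₀, x̲)` of the slab `{x⁰ = τ₀}` (`Minkowski.mem_causalPast_vacuumCauchyDevelopment`, the solid
  cone description of `J⁻` in `ℝ⁴₁`, O'Neill 1983, Ch. 14, p. 402). Hence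
  `FinalStateDecomposition_nonempty : Nonempty (FinalStateDecomposition
  Minkowski.vacuumCauchyDevelopment.toSpacetime univ k)` (the shape `𝒟.toSpacetime O k` of the
  items, at `𝒟 = ` Minkowski, `O = univ`), registered as an instance, and the same for
  `Minkowski.spacetime`. This is the trivial case of the stability of Minkowski space
  (Christodoulou–Klainerman 1993, Thm. 1.0.3, p. 20: the trivial data are the centre `Q = 0` of the
  smallness class and develop into Minkowski space, which is "globally asymptotically flat"), i.e.
  the `N = 0` instance of the final state picture (Penrose 1982, Problem 12).
* **Empty exactly over regions with empty interior (structural).** Every late-time chart is an open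
  embedding of the *nonempty* late region `{t > τ₀}` of its background into `𝒟`
  (`Spacetime.IsLateChart.image_subset_interior`; the late half-space of the flat background is
  nonempty, `Minkowski.lateRegion_nonempty`, and so is the late region of every boosted Kerr
  background, `boostedKerrBackground_lateRegion_nonempty`, because the Kerr–Schild slab
  `{t* = τ}` reaches `r = ∞`, `Kerr.exists_mem_region_apply_zero_eq`). Hence the charted late
  region `d.charted` of any decomposition is a nonempty open subset of `𝒟`
  (`FinalStateDecomposition.isOpen_charted`, `charted_nonempty`, `charted_subset_interior`), so
  `interior 𝒟 ≠ ∅` (`FinalStateDecomposition.interior_nonempty`) and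
  `FinalStateDecomposition_isEmpty : interior 𝒟 = ∅ → IsEmpty (FinalStateDecomposition 𝓢 𝒟 k)`
  (in particular over `𝒟 = ∅`, `FinalStateDecomposition_isEmpty_empty`); consequently the
  universally quantified form `∀ 𝓢 𝒟 k, Nonempty (FinalStateDecomposition 𝓢 𝒟 k)` is false
  (`not_forall_nonempty_finalStateDecomposition`). Items quantifying `∀ d : FinalStateDecomposition
  𝓢 𝒟 k` over a region `𝒟` with empty interior are vacuous; over the regions the routes actually
  use (domains of outer communication, `univ`, causal futures of the data) they are not, by the
  first half.

Conditional constructors already in the tree, for reference: `FinalStateDecomposition.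
ofConvergesToMinkowski` (`N = 0` from `ConvergesToMinkowski`, `KerrConvergence.lean`) and
`nonempty_finalStateDecomposition_of_convergesToKerr_holds` (`N = 1` from `ConvergesToKerr`,
`0 < M`, `|a| ≤ M`; `KerrConvergenceProofs.lean`).

## References

* D. Christodoulou, S. Klainerman, *The global nonlinear stability of the Minkowski space*,
  Princeton Mathematical Series 41, Princeton 1993, Thm. 1.0.3 (p. 20). [ChristodoulouKlainerman1993PMS41]
* R. Penrose, *Some unsolved problems in classical general relativity* (1982), Problem 12. [Penrose1982]
* B. O'Neill, *Semi-Riemannian geometry*, Academic Press 1983, Ch. 14, p. 402 (causality of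
  `ℝ⁴₁`). [ONeill1983]
* M. Dafermos, G. Holzegel, I. Rodnianski, M. Taylor, arXiv:2104.08222, §1 (late-time charts on
  `{t* ≥ τ₀}`). [arXiv210408222]
-/

noncomputable section

open TopologicalSpace Manifold Filter Topology Set Function
open scoped ContDiff Topology ENNReal

universe u

namespace Literature.Geometry.Lorentzian

/-! ### Late-time charts have open image in the interior of the region -/

namespace Spacetime.IsLateChart

variable {𝓢 : Spacetime.{u} 4} {B : ModelBackground} {𝒟 : Set 𝓢.carrier} {τ₀ : ℝ}
  {Ψ : B.domain → 𝓢.carrier}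

/-- The image `Ψ({t > τ₀})` of the late region under a late-time chart is open in the spacetime
(the restriction of `Ψ` to the late region is an open embedding). DHRT arXiv:2104.08222, §1
(the late-time chart covers the open region `{t* > τ₀}`). [cite: arXiv210408222, §1] -/
theorem isOpen_image (h : 𝓢.IsLateChart B 𝒟 τ₀ Ψ) : IsOpen (Ψ '' B.lateRegion τ₀) := by
  rw [← range_restrict]
  exact h.isOpenEmbedding.isOpen_range

/-- Hence the image of the late region lies in the **interior** of the region `𝒟` it is a chart
of (it is an open subset of `𝒟`). DHRT arXiv:2104.08222, §1. [cite: arXiv210408222, §1] -/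
theorem image_subset_interior (h : 𝓢.IsLateChart B 𝒟 τ₀ Ψ) :
    Ψ '' B.lateRegion τ₀ ⊆ interior 𝒟 :=
  interior_maximal h.image_subset h.isOpen_image

end Spacetime.IsLateChart

/-! ### Late regions of the reference backgrounds are nonempty -/

/-- The late half-space `{x⁰ > τ₀}` of Minkowski space is nonempty: it contains `(τ₀ + 1, 0)`.
[folklore] -/
theorem Minkowski.lateRegion_nonempty (τ₀ : ℝ) : (Minkowski.lateRegion τ₀).Nonempty :=
  ⟨E4.ofTimeSpace (τ₀ + 1) 0, show τ₀ < E4.ofTimeSpace (τ₀ + 1) 0 0 by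
    rw [E4.ofTimeSpace_apply_zero]; exact lt_add_one τ₀⟩

/-- **Every Kerr–Schild slab `{t* = τ}` meets every chart region `{r > max r₀ 0}`**: the point
`x = (τ, L, 0, 0)` with `L = |a| + |r₀| + 1` has `r(a, x)² ≥ ‖x̲‖² − a² = L² − a² > r₀²`
(`Kerr.radius_sq`: `r² = ((ρ² − a²) + √((ρ² − a²)² + 4a²z²))/2 ≥ ρ² − a²`), so `r(a, x) > max r₀ 0`.
In particular the Kerr exterior `{r > r₊}` is nonempty on every slab (the level sets `{r = c}` are
the confocal ellipsoids `(x² + y²)/(c² + a²) + z²/c² = 1`, exhausting `ℝ³` as `c → ∞`).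
Visser arXiv:0706.0622, (35); Dafermos–Rodnianski arXiv:0811.0354, §5.1. [cite: arXiv07060622, (35)] -/
theorem Kerr.exists_mem_region_apply_zero_eq (a r₀ τ : ℝ) :
    ∃ x : E4, x ∈ Kerr.region a r₀ ∧ x 0 = τ := by
  set L : ℝ := |a| + |r₀| + 1 with hL
  set x : E4 := τ • E4.basisVector 0 + L • E4.basisVector 1 with hx
  have hx0 : x 0 = τ := by simp [hx, E4.basisVector]
  have hx1 : x 1 = L := by simp [hx, E4.basisVector]
  have hx2 : x 2 = 0 := by simp [hx, E4.basisVector]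
  have hx3 : x 3 = 0 := by simp [hx, E4.basisVector]
  refine ⟨x, ?_, hx0⟩
  rw [Kerr.mem_region]
  have hnorm : E4.spatialNorm x ^ 2 = L ^ 2 := by
    rw [E4.spatialNorm_sq, hx1, hx2, hx3]; ring
  -- `‖x̲‖² − a² ≤ r²`
  have hle : E4.spatialNorm x ^ 2 - a ^ 2 ≤ Kerr.radius a x ^ 2 := by
    rw [Kerr.radius_sq]
    linarith [Kerr.abs_le_sqrt_radius_discr a x, le_abs_self (E4.spatialNorm x ^ 2 - a ^ 2)]
  rw [hnorm] at hle
  have hmax : max r₀ 0 ≤ |r₀| := max_le (le_abs_self r₀) (abs_nonneg r₀)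
  have hmax₀ : 0 ≤ max r₀ 0 := le_max_right r₀ 0
  have hm2 : max r₀ 0 ^ 2 ≤ |r₀| ^ 2 := pow_le_pow_left₀ hmax₀ hmax 2
  have hsq : max r₀ 0 ^ 2 < Kerr.radius a x ^ 2 := by
    nlinarith [abs_nonneg a, abs_nonneg r₀, sq_abs a, mul_nonneg (abs_nonneg a) (abs_nonneg r₀)]
  exact lt_of_pow_lt_pow_left₀ 2 (Kerr.radius_nonneg a x) hsq

/-- The Kerr exterior `{r > r₊}` meets every Kerr–Schild slab `{t* = τ}` (special case
`r₀ = r₊` of `Kerr.exists_mem_region_apply_zero_eq`). Dafermos–Rodnianski arXiv:0811.0354, §5.1.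
[cite: arXiv08110354, §5.1] -/
theorem Kerr.exists_mem_exterior_apply_zero_eq (M a τ : ℝ) :
    ∃ x : E4, x ∈ Kerr.exterior M a ∧ x 0 = τ :=
  Kerr.exists_mem_region_apply_zero_eq a (Kerr.rPlus M a) τ

/-- The inverse Poincaré map undoes the motion: `Λ⁻¹((Λ z + c) − c) = z` (O'Neill 1983, Ch. 9,
p. 236). [cite: ONeill1983, Ch. 9 p. 236] -/
@[simp]
theorem poincareInv_apply_add (Λ : lorentzGroup) (c z : E4) :
    poincareInv Λ c ((Λ : E4 ≃L[ℝ] E4) z + c) = z := by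
  rw [poincareInv, add_sub_cancel_right, ContinuousLinearEquiv.symm_apply_apply]

/-- **The late region `{t*ᵢ > τ₀}` of a boosted, translated Kerr background is nonempty**: if
`z ∈ Kerr.exterior M a` has rest-frame time `z⁰ = τ₀ + 1` (`Kerr.exists_mem_exterior_apply_zero_eq`),
then `Λ z + c` lies in the boosted exterior with rest-frame time `τ₀ + 1`. Klainerman, "Brief
history of the black hole stability problem", §4 (moving Kerr black holes; no printed
formulation, see `KerrConvergence.lean`). [folklore] -/
theorem boostedKerrBackground_lateRegion_nonempty (Λ : lorentzGroup) (c : E4) (M a τ₀ : ℝ) :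
    ((boostedKerrBackground Λ c M a).lateRegion τ₀).Nonempty := by
  obtain ⟨z, hz, hz0⟩ := Kerr.exists_mem_exterior_apply_zero_eq M a (τ₀ + 1)
  have hmem : (Λ : E4 ≃L[ℝ] E4) z + c ∈ boostedKerrExterior Λ c M a := by
    rw [mem_boostedKerrExterior, poincareInv_apply_add]
    exact hz
  refine ⟨⟨(Λ : E4 ≃L[ℝ] E4) z + c, hmem⟩, ?_⟩
  show τ₀ < poincareInv Λ c ((Λ : E4 ≃L[ℝ] E4) z + c) 0
  rw [poincareInv_apply_add, hz0]
  exact lt_add_one τ₀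

/-! ### Structural consequences: the charted late region is a nonempty open subset of `𝒟` -/

namespace FinalStateDecomposition

variable {𝓢 : Spacetime.{u} 4} {𝒟 : Set 𝓢.carrier} {k : ℕ}

/-- Each black-hole region `chart i ({t*ᵢ > τ₀})` of a final state decomposition is open.
DHRT arXiv:2104.08222, §1 (late-time charts are open embeddings). [cite: arXiv210408222, §1] -/
theorem isOpen_region (d : FinalStateDecomposition 𝓢 𝒟 k) (i : Fin d.N) : IsOpen (d.region i) :=
  (d.isLateChart i).isOpen_image

/-- The radiation zone `flatChart ({x⁰ > τ₀} ∩ U₀)` of a final state decomposition is open.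
DHRT arXiv:2104.08222, §1. [cite: arXiv210408222, §1] -/
theorem isOpen_radiationZone (d : FinalStateDecomposition 𝓢 𝒟 k) : IsOpen d.radiationZone :=
  d.isLateChart_flat.isOpen_image

/-- Each black-hole region of a final state decomposition is nonempty (the late region of a
boosted Kerr background is, `boostedKerrBackground_lateRegion_nonempty`). [folklore] -/
theorem region_nonempty (d : FinalStateDecomposition 𝓢 𝒟 k) (i : Fin d.N) :
    (d.region i).Nonempty :=
  (boostedKerrBackground_lateRegion_nonempty _ _ _ _ _).image _

/-- With no black hole (`N = 0`) the radiation zone is nonempty: the flat domain then contains the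
whole late half-space `{x⁰ > τ₀}` (`lateRegion_subset_flatDomain_of_N_eq_zero`), which is
nonempty. Christodoulou–Klainerman 1993, Thm. 1.0.3 (p. 20) (the radiation-only final state).
[cite: ChristodoulouKlainerman1993PMS41, Thm. 1.0.3 (p. 20)] -/
theorem radiationZone_nonempty_of_N_eq_zero (d : FinalStateDecomposition 𝓢 𝒟 k) (hN : d.N = 0) :
    d.radiationZone.Nonempty := by
  obtain ⟨x, hx⟩ := Minkowski.lateRegion_nonempty d.τ₀
  exact ⟨d.flatChart ⟨x, d.lateRegion_subset_flatDomain_of_N_eq_zero hN hx⟩,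
    ⟨⟨x, d.lateRegion_subset_flatDomain_of_N_eq_zero hN hx⟩, hx, rfl⟩⟩

/-- The charted late region (radiation zone and black-hole regions) of a final state decomposition
is open. Klainerman, C. R. Mécanique 353 (2025), §1.1.1; DHRT arXiv:2104.08222, §1. [cite: arXiv210408222, §1] -/
theorem isOpen_charted (d : FinalStateDecomposition 𝓢 𝒟 k) : IsOpen d.charted :=
  d.isOpen_radiationZone.union (isOpen_iUnion d.isOpen_region)

/-- **The charted late region of a final state decomposition is nonempty**: with a black hole,
its region is nonempty; with none, the radiation zone is. [folklore] -/
theorem charted_nonempty (d : FinalStateDecomposition 𝓢 𝒟 k) : d.charted.Nonempty := by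
  rcases Nat.eq_zero_or_pos d.N with hN | hN
  · exact (d.radiationZone_nonempty_of_N_eq_zero hN).mono d.radiationZone_subset_charted
  · exact (d.region_nonempty ⟨0, hN⟩).mono (d.region_subset_charted ⟨0, hN⟩)

/-- The charted late region lies in the interior of the decomposed region `𝒟` (it is an open
subset of `𝒟`, `charted_subset`). [folklore] -/
theorem charted_subset_interior (d : FinalStateDecomposition 𝓢 𝒟 k) : d.charted ⊆ interior 𝒟 :=
  interior_maximal d.charted_subset d.isOpen_charted

/-- **A region admitting a final state decomposition has nonempty interior.** [folklore] -/
theorem interior_nonempty (d : FinalStateDecomposition 𝓢 𝒟 k) : (interior 𝒟).Nonempty :=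
  d.charted_nonempty.mono d.charted_subset_interior

/-- In particular a region admitting a final state decomposition is nonempty. [folklore] -/
theorem nonempty (d : FinalStateDecomposition 𝓢 𝒟 k) : 𝒟.Nonempty :=
  d.interior_nonempty.mono interior_subset

end FinalStateDecomposition

/-- **`IsEmpty` region of the carrier (structural finding of the census).** Over a region `𝒟`
with EMPTY INTERIOR — in particular `𝒟 = ∅`, or any `𝒟` contained in a hypersurface — the
hypothesis structure `FinalStateDecomposition 𝓢 𝒟 k` is uninhabited for every spacetime `𝓢`
and every `k`, because its charts are open embeddings of nonempty open sets into `𝒟`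
(`FinalStateDecomposition.interior_nonempty`); every item universally quantified over such a `d`
is vacuous there. This is the exact trivially-empty region: nothing beyond `(interior 𝒟).Nonempty`
follows from the chart clauses alone. [folklore] -/
theorem FinalStateDecomposition_isEmpty {𝓢 : Spacetime.{u} 4} {𝒟 : Set 𝓢.carrier}
    (h𝒟 : interior 𝒟 = ∅) (k : ℕ) : IsEmpty (FinalStateDecomposition 𝓢 𝒟 k) :=
  ⟨fun d ↦ by simpa [h𝒟] using d.interior_nonempty⟩

/-- The empty region of any spacetime admits no final state decomposition. [folklore] -/
theorem FinalStateDecomposition_isEmpty_empty (𝓢 : Spacetime.{u} 4) (k : ℕ) :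
    IsEmpty (FinalStateDecomposition 𝓢 ∅ k) :=
  FinalStateDecomposition_isEmpty interior_empty k

/-! ### The explicit witness: the trivial final state of Minkowski space -/

namespace Minkowski

/-- **The trivial final state decomposition of Minkowski space.** For the Minkowski development
`Minkowski.vacuumCauchyDevelopment` of the data `(ℝ³, δ, 0)` (carrier `E4`, metric `η`), every
`k`, every `τ₀` and every region `O ⊇ {x⁰ > τ₀}`: no black hole (`N = 0`, all `Fin 0`-indexed data
empty, separation and excision clauses vacuous), flat domain `⊤ = E4`, flat chart the identity
`Subtype.val` after `τ₀` — a late-time chart (`isLateChart_vacuumCauchyDevelopment_subtypeVal`: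
smooth, an open embedding on `{x⁰ > τ₀}`) with late image `{x⁰ > τ₀} ⊆ O` — whose `Cᵏ` deviation
from `η` is identically `0` (`deviationCk_vacuumCauchyDevelopment_subtypeVal`), and covering
clause: a point of `O` not in `{x⁰ > τ₀}` has `x⁰ ≤ τ₀` and lies on the vertical timelike segment
below `(τ₀, x̲) ∈ {x⁰ = τ₀}`, hence in `J⁻({x⁰ = τ₀})` (`mem_causalPast_vacuumCauchyDevelopment`;
O'Neill 1983, Ch. 14, p. 402). The trivial (`Q = 0`) case of Christodoulou–Klainerman 1993,
Thm. 1.0.3 (p. 20); the `N = 0` instance of Penrose 1982, Problem 12.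
[cite: ChristodoulouKlainerman1993PMS41, Thm. 1.0.3 (p. 20)] -/
def finalStateDecomposition (k : ℕ) (τ₀ : ℝ) {O : Set E4} (hO : Minkowski.lateRegion τ₀ ⊆ O) :
    FinalStateDecomposition vacuumCauchyDevelopment.toSpacetime O k where
  N := 0
  mass := Fin.elim0
  spin := Fin.elim0
  mass_pos i := i.elim0
  abs_spin_le_mass i := i.elim0
  motion := Fin.elim0
  τ₀ := τ₀
  chart i := i.elim0
  isLateChart i := i.elim0
  tendsto_truncDeviationCk i := i.elim0
  exists_pairwise_disjoint _ := ⟨0, fun i ↦ i.elim0⟩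
  excision := Fin.elim0
  tendsto_excision_div i := i.elim0
  flatDomain := ⊤
  setOf_lt_excision_subset_flatDomain _ _ := trivial
  flatChart := Subtype.val
  isLateChart_flat :=
    { contMDiff := (isLateChart_vacuumCauchyDevelopment_subtypeVal τ₀).contMDiff
      isOpenEmbedding := (isLateChart_vacuumCauchyDevelopment_subtypeVal τ₀).isOpenEmbedding
      image_subset := by
        rintro _ ⟨x, hx, rfl⟩
        exact hO hx }
  tendsto_deviationCk_flat :=
    tendsto_const_nhds.congr fun τ ↦ (deviationCk_vacuumCauchyDevelopment_subtypeVal k τ).symm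
  diff_subset_causalPast := by
    rw [Set.iUnion_of_empty, Set.empty_union, Set.iUnion_of_empty, Set.empty_union]
    rintro x ⟨-, hx⟩
    change E4 at x
    have hx0 : ¬ τ₀ < x 0 := fun h ↦ hx ⟨⟨x, trivial⟩, h, rfl⟩
    have hq : x ∈ vacuumCauchyDevelopment.metric.causalPast vacuumCauchyDevelopment.timeOrientation
        ({E4.ofTimeSpace τ₀ (E4.spatial x)} : Set E4) :=
      mem_causalPast_vacuumCauchyDevelopment (by
        rw [E4.spatial_ofTimeSpace, sub_self, norm_zero, E4.ofTimeSpace_apply_zero]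
        linarith [not_lt.1 hx0])
    refine LorentzianMetric.causalFuture_mono (singleton_subset_iff.2 ?_) hq
    exact ⟨⟨E4.ofTimeSpace τ₀ (E4.spatial x), trivial⟩, E4.ofTimeSpace_apply_zero τ₀ (E4.spatial x),
      rfl⟩

variable (k : ℕ) (τ₀ : ℝ) {O : Set E4} (hO : Minkowski.lateRegion τ₀ ⊆ O)

/-- The trivial decomposition has no black hole (by `rfl`). [folklore] -/
@[simp]
theorem finalStateDecomposition_N : (finalStateDecomposition k τ₀ hO).N = 0 := rfl

/-- The trivial decomposition starts at the prescribed late time `τ₀` (by `rfl`). [folklore] -/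
@[simp]
theorem finalStateDecomposition_τ₀ : (finalStateDecomposition k τ₀ hO).τ₀ = τ₀ := rfl

/-- The flat domain of the trivial decomposition is all of `E4` (by `rfl`). [folklore] -/
@[simp]
theorem finalStateDecomposition_flatDomain : (finalStateDecomposition k τ₀ hO).flatDomain = ⊤ :=
  rfl

/-- The flat chart of the trivial decomposition is the identity chart `Subtype.val` (by `rfl`).
[folklore] -/
@[simp]
theorem finalStateDecomposition_flatChart :
    (finalStateDecomposition k τ₀ hO).flatChart = Subtype.val := rfl

/-- The radiation zone of the trivial decomposition is the late half-space `{x⁰ > τ₀}`.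
Christodoulou–Klainerman 1993, Thm. 1.0.3 (p. 20) (radiation-only final state).
[cite: ChristodoulouKlainerman1993PMS41, Thm. 1.0.3 (p. 20)] -/
@[simp]
theorem radiationZone_finalStateDecomposition :
    (finalStateDecomposition k τ₀ hO).radiationZone = Minkowski.lateRegion τ₀ :=
  image_lateRegion_background τ₀

/-- The charted late region of the trivial decomposition is the late half-space `{x⁰ > τ₀}` (no
black-hole region). Christodoulou–Klainerman 1993, Thm. 1.0.3 (p. 20).
[cite: ChristodoulouKlainerman1993PMS41, Thm. 1.0.3 (p. 20)] -/
@[simp]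
theorem charted_finalStateDecomposition :
    (finalStateDecomposition k τ₀ hO).charted = Minkowski.lateRegion τ₀ := by
  haveI : IsEmpty (Fin (finalStateDecomposition k τ₀ hO).N) := Fin.isEmpty'
  rw [FinalStateDecomposition.charted, Set.iUnion_of_empty, Set.union_empty]
  exact radiationZone_finalStateDecomposition k τ₀ hO

end Minkowski

/-- **Carrier witness (libB-FinalStateConjecture-07): `FinalStateDecomposition` is inhabited at the
standard parameters** — Minkowski space as the vacuum Cauchy development of the trivial data, the
whole carrier as region, every differentiability order `k` (the shape
`FinalStateDecomposition 𝒟.toSpacetime O k` in which the summit's items consume the carrier).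
The witness is the explicit trivial decomposition `Minkowski.finalStateDecomposition k 0`
(`N = 0`, identity flat chart after `τ₀ = 0`). NOT inhabited at all parameters:
`FinalStateDecomposition_isEmpty` (empty interior), `not_forall_nonempty_finalStateDecomposition`.
Christodoulou–Klainerman 1993, Thm. 1.0.3 (p. 20), trivial case.
[cite: ChristodoulouKlainerman1993PMS41, Thm. 1.0.3 (p. 20)] -/
theorem FinalStateDecomposition_nonempty (k : ℕ) :
    Nonempty (FinalStateDecomposition Minkowski.vacuumCauchyDevelopment.toSpacetime univ k) :=
  ⟨Minkowski.finalStateDecomposition k 0 (subset_univ _)⟩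

/-- The same witness over the bundled Minkowski spacetime `Minkowski.spacetime`
(`vacuumCauchyDevelopment.toSpacetime = spacetime` by `rfl`). Christodoulou–Klainerman 1993,
Thm. 1.0.3 (p. 20), trivial case. [cite: ChristodoulouKlainerman1993PMS41, Thm. 1.0.3 (p. 20)] -/
theorem FinalStateDecomposition_nonempty_spacetime (k : ℕ) :
    Nonempty (FinalStateDecomposition Minkowski.spacetime univ k) :=
  FinalStateDecomposition_nonempty k

/-- More generally every region of Minkowski space containing a late half-space `{x⁰ > τ₀}` admits
the trivial decomposition after `τ₀`. Christodoulou–Klainerman 1993, Thm. 1.0.3 (p. 20), trivial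
case. [cite: ChristodoulouKlainerman1993PMS41, Thm. 1.0.3 (p. 20)] -/
theorem FinalStateDecomposition_nonempty_of_lateRegion_subset (k : ℕ) {τ₀ : ℝ} {O : Set E4}
    (hO : Minkowski.lateRegion τ₀ ⊆ O) :
    Nonempty (FinalStateDecomposition Minkowski.vacuumCauchyDevelopment.toSpacetime O k) :=
  ⟨Minkowski.finalStateDecomposition k τ₀ hO⟩

/-- Instance form of `FinalStateDecomposition_nonempty` (Minkowski development, whole carrier).
Christodoulou–Klainerman 1993, Thm. 1.0.3 (p. 20), trivial case.
[cite: ChristodoulouKlainerman1993PMS41, Thm. 1.0.3 (p. 20)] -/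
instance (k : ℕ) :
    Nonempty (FinalStateDecomposition Minkowski.vacuumCauchyDevelopment.toSpacetime univ k) :=
  FinalStateDecomposition_nonempty k

/-- Instance form of `FinalStateDecomposition_nonempty_spacetime` (bundled Minkowski spacetime,
whole carrier). Christodoulou–Klainerman 1993, Thm. 1.0.3 (p. 20), trivial case.
[cite: ChristodoulouKlainerman1993PMS41, Thm. 1.0.3 (p. 20)] -/
instance (k : ℕ) : Nonempty (FinalStateDecomposition Minkowski.spacetime univ k) :=
  FinalStateDecomposition_nonempty_spacetime k

/-- **The carrier is conditional, not universally inhabited**: it is empty over the empty region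
of Minkowski space (`FinalStateDecomposition_isEmpty_empty`) and inhabited over all of it
(`FinalStateDecomposition_nonempty`). [folklore] -/
theorem not_forall_nonempty_finalStateDecomposition :
    ¬ ∀ (𝓢 : Spacetime.{0} 4) (𝒟 : Set 𝓢.carrier) (k : ℕ),
      Nonempty (FinalStateDecomposition 𝓢 𝒟 k) :=
  fun h ↦ (FinalStateDecomposition_isEmpty_empty Minkowski.spacetime 0).false (h _ ∅ 0).some

end Literature.Geometry.Lorentzian

end
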